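import Summits.CriticalPhenomena.PercolationContinuityZ3.Theorems.Transplant.SharpnessRayDuality
import Literature.Probability.Percolation.HalfPlaneArmAxisInputs
import Literature.Probability.Percolation.Z2HalfPlaneTwoArm
import Literature.Probability.Percolation.HalfPlaneCrossingGluing
import Literature.Probability.Percolation.HalfSpaceHighDimPlaced
import Literature.Probability.Percolation.IsoradialCriticalityProofs
import HarnessLib

/-!
# Transplant sharpness LXV — the pieces of the blocking event of the reinforced ray: locality, monotonicity and laws
# of the U-structures, the arms and the bridges under `P^{G_ray}_{1/2}`

builds on p205010 (kernel theorem, internal audit signed; external expert review pending).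
Status sentence (coordinator 2026-08-20T04:30Z): "θ(p_c) = 0 on ℤ^d, all d ≥ 2 — kernel-verified (Lean 4/Mathlib,
standard axioms); internal adversarial audit SIGNED 2026-08-20 04:29Z; external expert review pending."

Lane `prim-bschramm`, seat p5 (sharpness); memo `run/shared/lean/prim/bschramm/P5-SHARPNESS.md` §48, row 85 (kernel
programme "RAY"; plan `run/shared/lean/prim/bschramm/prim-bschramm-p5-g22/RAY-PLAN.md` §2–§3, module L7a, first half).

With the notation of LXIV (`SU[t]`, `OA[x,R]`, the face reflection `Φ = reflY (-1)`), `η = dualConfig (effConfig ω)`: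

* `Sup[t] = [0,48t]²` (faces of the upper part) and `Dplus[t]` its pairs; `Dminus[t] = Φ⁻¹ Dplus[t]`;
  `determinedBy_SU`, `determinedBy_OA_plus` — the upper events are determined by `Dplus[t]`; no bridge lies in
  `Dplus[t]` or `Dminus[t]` (`bridge_not_mem_Dplus`, `bridge_not_mem_Dminus`);
* `real_eta_plus`, `real_eta_minus` — **laws**: `P^{G_ray}_{1/2}(η ∈ E) = P_{1/2}(E) = P^{G_ray}_{1/2}(Φη ∈ E)` for `E`
  determined by `Dplus[t]` (LXIII transfer, `P_{1/2}`-invariance under `Φ`);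
* `disjoint_plus_minus`, `disjoint_plus_ray`, `disjoint_minus_ray` — the lattice pair sets behind the upper events, the
  lower events and the bridges are pairwise disjoint (independence under the product measure, LXVI);
* `SU_lower` — `P_{1/2}(SU[t]) ≥ c_U > 0` for `t ≥ t_U` (Nolin's U, `HalfPlaneArm.real_U_ge`, a tall crossing,
  `HalfPlaneArm.tb_lower`, Harris); `short_lower` — `P^{G_ray}_{1/2}(ω̃ ∉ T/B/L short crossing of scale n) ≥ c_H`
  (`rsw_lowerBound.le_one_sub_crossingProb`, transferred off the ray).
-/

noncomputable section

namespace Summit.CriticalPhenomena.PercolationContinuityZ3.Theorems.TransplantSharpness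

namespace Ray

open Literature.Probability.Percolation Literature.Probability.LatticeModels
open Literature.Probability.Percolation.Z2HalfPlane (Far siteBox mem_siteBox)
open MeasureTheory Filter Set SimpleGraph

local notation3 "box[" A₁ ", " A₂ ", " B₁ ", " B₂ "]" =>
  {v : Site 2 | (A₁ : ℤ) ≤ v 0 ∧ v 0 ≤ (A₂ : ℤ) ∧ (B₁ : ℤ) ≤ v 1 ∧ v 1 ≤ (B₂ : ℤ)}
local notation3 "LR[" A₁ ", " A₂ ", " B₁ ", " B₂ "]" =>
  openCrossing box[A₁, A₂, B₁, B₂] {v : Site 2 | v 0 = (A₁ : ℤ)} {v : Site 2 | v 0 = (A₂ : ℤ)}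
local notation3 "TB[" A₁ ", " A₂ ", " B₁ ", " B₂ "]" =>
  openCrossing box[A₁, A₂, B₁, B₂] {v : Site 2 | v 1 = (B₁ : ℤ)} {v : Site 2 | v 1 = (B₂ : ℤ)}
local notation3 "OA[" a ", " R "]" =>
  {ω : BondConfig (Site 2) | ∃ v : Site 2, Far R a v ∧ ω ∈ openConnIn ↑(siteBox a R) ![a, 0] v}
local notation3 "SU[" t "]" =>
  ((TB[(32 : ℤ) * t + 2 * t, (32 : ℤ) * t + 2 * (2 * t), (0 : ℤ), (0 : ℤ) + 2 * (2 * t)] ∩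
    LR[(32 : ℤ) * t - 2 * (2 * t), (32 : ℤ) * t + 2 * (2 * t), (0 : ℤ) + 2 * t, (0 : ℤ) + 2 * (2 * t)] ∩
    TB[(32 : ℤ) * t - 2 * (2 * t), (32 : ℤ) * t - 2 * t, (0 : ℤ), (0 : ℤ) + 2 * (2 * t)]) ∩
    TB[(28 : ℤ) * t, (28 : ℤ) * t + 8 * t, (2 : ℤ) * t, (2 : ℤ) * t + 46 * t])
local notation3 "refl[" ω "]" => BondConfig.relabel (sym2Equiv (reflY (-1)).toEquiv) (ω : BondConfig (Site 2))
local notation3 "liftPairs[" F "]" => {E : Sym2 (Site 2 ⊕ ℕ) |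
  (∃ e ∈ (F : Set (Sym2 (Site 2))), E = e.map Sum.inl) ∨
  ∃ k : ℕ, rayEdge k ∈ (F : Set (Sym2 (Site 2))) ∧
    (E = s(Sum.inl (rayPt k false), Sum.inr k) ∨ E = s(Sum.inr k, Sum.inl (rayPt k true)))}
local notation3 "μ[" p "]" => bondPercolation rayGraph p
local notation3 "P[" p "]" => bondPercolation (zdGraph 2) p
local notation3 "bridge[" k "]" => (s(![((k : ℕ) : ℤ), -1], ![((k : ℕ) : ℤ), 0]) : Sym2 (Site 2))
/-- `η`-preimages: `ηinv[E] = {ω | dualConfig (effConfig ω) ∈ E}`. -/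
local notation3 "ηinv[" E "]" => (fun ω : BondConfig (Site 2 ⊕ ℕ) => dualConfig (effConfig ω)) ⁻¹' (E : Set (BondConfig (Site 2)))
/-- The faces of the upper part: `[0,48t]²`. -/
local notation3 "Sup[" t "]" => (Finset.Icc ![(0 : ℤ), 0] ![(48 : ℤ) * t, (48 : ℤ) * t] : Finset (Site 2))
/-- Their pairs. -/
local notation3 "Dplus[" t "]" => (↑((Sup[t]).sym2) : Set (Sym2 (Site 2)))
/-- The reflected pairs (faces of the lower part). -/
local notation3 "Dminus[" t "]" => ((sym2Equiv (reflY (-1)).toEquiv) ⁻¹' Dplus[t])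

/-! ### Locality of the upper events -/

/-- Membership in `Sup[t]`. [folklore] -/
theorem mem_Sup {t : ℕ} {v : Site 2} : v ∈ Sup[t] ↔ (0 ≤ v 0 ∧ v 0 ≤ 48 * t) ∧ (0 ≤ v 1 ∧ v 1 ≤ 48 * t) := by
  rw [Finset.mem_Icc, Pi.le_def, Pi.le_def, Fin.forall_fin_two, Fin.forall_fin_two]
  simp only [Matrix.cons_val_zero, Matrix.cons_val_one]
  tauto

/-- `SU[t]` is determined by the pairs of `[0,48t]²`. [folklore] -/
theorem determinedBy_SU (t : ℕ) : DeterminedBy SU[t] Dplus[t] := by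
  refine ((DeterminedBy.inter (DeterminedBy.inter ?_ ?_) ?_).inter ?_) <;>
    refine IsoradialCriticality.determinedBy_openCrossing_of_subset (fun v hv => Finset.mem_coe.2 (mem_Sup.2 ?_)) _ _ <;>
    obtain ⟨h1, h2, h3, h4⟩ := hv <;> refine ⟨⟨by omega, by omega⟩, by omega, by omega⟩

/-- `SU[t]` is measurable. [folklore] -/
theorem measurableSet_SU (t : ℕ) : MeasurableSet SU[t] := (determinedBy_SU t).measurableSet_of_finset

/-- `SU[t]` is increasing. [folklore] -/
theorem isUpperSet_SU (t : ℕ) : IsUpperSet SU[t] :=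
  (((isUpperSet_openCrossing _ _ _).inter (isUpperSet_openCrossing _ _ _)).inter (isUpperSet_openCrossing _ _ _)).inter
    (isUpperSet_openCrossing _ _ _)

/-- The window arm is determined by the pairs of its box. [folklore] -/
theorem determinedBy_OA (a : ℤ) (R : ℕ) : DeterminedBy OA[a, R] (↑(siteBox a R).sym2 : Set (Sym2 (Site 2))) := by
  rw [determinedBy_iff]
  intro ω ω' hω
  simp only [mem_setOf_eq]
  refine exists_congr fun v => and_congr_right fun _ => ?_
  exact (determinedBy_iff _ _).1 (PlanarDuality.determinedBy_openConnIn (siteBox a R) ![a, 0] v) ω ω' hω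

/-- The window arm is measurable. [folklore] -/
theorem measurableSet_OA (a : ℤ) (R : ℕ) : MeasurableSet OA[a, R] := (determinedBy_OA a R).measurableSet_of_finset

/-- The window arm is increasing. [folklore] -/
theorem isUpperSet_OA (a : ℤ) (R : ℕ) : IsUpperSet OA[a, R] := by
  rintro ω ω' hle ⟨v, hv, hω⟩
  exact ⟨v, hv, isUpperSet_openConnIn _ _ _ hle hω⟩

/-- For an abscissa of the window, the arm box lies in `[0,48t]²`. [folklore] -/
theorem determinedBy_OA_plus {t k : ℕ} (hk : 32 * t ≤ k) (hk' : k < 33 * t) :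
    DeterminedBy OA[(k : ℤ), 8 * t] Dplus[t] := by
  refine (determinedBy_OA (k : ℤ) (8 * t)).mono (Finset.coe_subset.2 (Finset.sym2_mono fun v hv => ?_))
  have h := mem_siteBox.1 hv
  push_cast at h
  exact mem_Sup.2 ⟨⟨by omega, by omega⟩, h.2.1, by omega⟩

/-- Intersections of two arms of the window are determined by `Dplus[t]`. [folklore] -/
theorem determinedBy_OA_inter_plus {t k l : ℕ} (hk : 32 * t ≤ k) (hk' : k < 33 * t) (hl : 32 * t ≤ l) (hl' : l < 33 * t) :
    DeterminedBy (OA[(k : ℤ), 8 * t] ∩ OA[(l : ℤ), 8 * t]) Dplus[t] :=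
  (determinedBy_OA_plus hk hk').inter (determinedBy_OA_plus hl hl')

/-! ### No bridge among the upper or lower pairs -/

/-- No bridge is a pair of `[0,48t]²`. [folklore] -/
theorem bridge_not_mem_Dplus (t k : ℕ) : bridge[k] ∉ Dplus[t] := by
  intro h
  have := Finset.mem_sym2_iff.1 (Finset.mem_coe.1 h) ![(k : ℤ), -1] (Sym2.mem_mk_left _ _)
  have := (mem_Sup.1 this).2.1
  simp at this

/-- No bridge is a reflected pair of `[0,48t]²` (the reflection exchanges the two faces of a bridge). [folklore] -/
theorem bridge_not_mem_Dminus (t k : ℕ) : bridge[k] ∉ Dminus[t] := by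
  intro h
  rw [Set.mem_preimage, sym2Equiv_apply, Sym2.map_mk] at h
  have := Finset.mem_sym2_iff.1 (Finset.mem_coe.1 h) ((reflY (-1)).toEquiv ![(k : ℤ), 0]) (Sym2.mem_mk_right _ _)
  have := (mem_Sup.1 this).2.1
  simp [RelIso.coe_fn_toEquiv] at this

/-! ### Laws of the upper and lower events -/

/-- **Law of an upper event**: `P^{G_ray}_{1/2}(η ∈ E) = P_{1/2}(E)` for `E` determined by `Dplus[t]`. [folklore] -/
theorem real_eta_plus {t : ℕ} {E : Set (BondConfig (Site 2))} (hE : DeterminedBy E Dplus[t]) (hEm : MeasurableSet E) :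
    (μ[half]).real ηinv[E] = (P[half]).real E :=
  real_preimage_eta_half hE (bridge_not_mem_Dplus t) hEm

/-- The reflected event is determined by the reflected pairs. [folklore] -/
theorem determinedBy_refl_preimage {t : ℕ} {E : Set (BondConfig (Site 2))} (hE : DeterminedBy E Dplus[t]) :
    DeterminedBy ((fun ω : BondConfig (Site 2) => refl[ω]) ⁻¹' E) Dminus[t] :=
  BGNd.determinedBy_preimage_relabel_bond _ hE

/-- The reflection of configurations is measurable. [folklore] -/
theorem measurable_refl : Measurable (fun ω : BondConfig (Site 2) => refl[ω]) := by
  refine measurable_set_iff.2 fun i => ?_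
  have : (fun ω : Set (Sym2 (Site 2)) => i ∈ refl[ω]) = fun ω => (sym2Equiv (reflY (-1)).toEquiv).symm i ∈ ω := by
    funext ω; rw [BondConfig.relabel_apply]; exact propext (by rw [Set.mem_image_equiv])
  rw [this]; exact measurable_set_mem _

/-- The reflected event is measurable. [folklore] -/
theorem measurableSet_refl_preimage {E : Set (BondConfig (Site 2))} (hEm : MeasurableSet E) :
    MeasurableSet ((fun ω : BondConfig (Site 2) => refl[ω]) ⁻¹' E) :=
  measurable_refl hEm

/-- The reflection of an increasing event is increasing. [folklore] -/
theorem isUpperSet_refl_preimage {E : Set (BondConfig (Site 2))} (hE : IsUpperSet E) :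
    IsUpperSet ((fun ω : BondConfig (Site 2) => refl[ω]) ⁻¹' E) := by
  intro ω ω' hle hω
  have hsub : refl[ω] ⊆ refl[ω'] := by
    intro e he
    rw [BondConfig.relabel_apply] at he ⊢
    obtain ⟨e', he', rfl⟩ := he
    exact ⟨e', hle he', rfl⟩
  exact hE hsub hω

/-- **Law of a lower event**: `P^{G_ray}_{1/2}(Φη ∈ E) = P_{1/2}(E)` for `E` determined by `Dplus[t]` (transfer off the
bridges and invariance of `P_{1/2}` under the lattice reflection `Φ`). [folklore] -/
theorem real_eta_minus {t : ℕ} {E : Set (BondConfig (Site 2))} (hE : DeterminedBy E Dplus[t]) (hEm : MeasurableSet E) :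
    (μ[half]).real ηinv[(fun ω : BondConfig (Site 2) => refl[ω]) ⁻¹' E] = (P[half]).real E := by
  rw [real_preimage_eta_half (determinedBy_refl_preimage hE) (bridge_not_mem_Dminus t) (measurableSet_refl_preimage hEm)]
  exact bondPercolation_real_preimage_relabel_iso (reflY (-1)) half E

/-! ### Disjointness of the pair sets -/

/-- The pairs behind the upper and the lower events are disjoint. [folklore] -/
theorem disjoint_plus_minus (t : ℕ) : Disjoint (dualEdge ⁻¹' Dplus[t]) (dualEdge ⁻¹' Dminus[t]) := by
  rw [Set.disjoint_left]
  intro e h1 h2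
  rw [Set.mem_preimage] at h1 h2
  rw [Set.mem_preimage, sym2Equiv_apply] at h2
  induction h : dualEdge e using Sym2.ind with
  | h a b =>
    rw [h] at h1 h2
    have ha := Finset.mem_sym2_iff.1 (Finset.mem_coe.1 h1) a (Sym2.mem_mk_left _ _)
    rw [Sym2.map_mk] at h2
    have ha' := Finset.mem_sym2_iff.1 (Finset.mem_coe.1 h2) ((reflY (-1)).toEquiv a) (Sym2.mem_mk_left _ _)
    have h3 := (mem_Sup.1 ha).2.1
    have h4 := (mem_Sup.1 ha').2.1
    simp only [RelIso.coe_fn_toEquiv, reflY_apply_one] at h4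
    omega

/-- The pairs behind the upper events avoid every ray edge. [folklore] -/
theorem disjoint_plus_ray (t k : ℕ) : Disjoint (dualEdge ⁻¹' Dplus[t]) ({rayEdge k} : Set (Sym2 (Site 2))) := by
  rw [Set.disjoint_singleton_right, Set.mem_preimage, dualEdge_rayEdge]
  exact bridge_not_mem_Dplus t k

/-- The pairs behind the lower events avoid every ray edge. [folklore] -/
theorem disjoint_minus_ray (t k : ℕ) : Disjoint (dualEdge ⁻¹' Dminus[t]) ({rayEdge k} : Set (Sym2 (Site 2))) := by
  rw [Set.disjoint_singleton_right, Set.mem_preimage, dualEdge_rayEdge]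
  exact bridge_not_mem_Dminus t k

/-- Distinct ray edges. [folklore] -/
theorem disjoint_ray_ray {k l : ℕ} (hkl : k ≠ l) : Disjoint ({rayEdge k} : Set (Sym2 (Site 2))) {rayEdge l} := by
  rw [Set.disjoint_singleton]; exact fun h => hkl (rayEdge_injective h)

/-! ### Lower bounds: the U-structure and the three short crossings -/

/-- **The U-structure is likely**: `P_{1/2}(SU[t]) ≥ c_U > 0` for all large `t` (Nolin's U by `HalfPlaneArm.real_U_ge`,
the tall `8t × 46t` crossing by `HalfPlaneArm.tb_lower`, glued by Harris–FKG).
[cite: Nolin2008, §4.6 with §4.3 (RSW and FKG in the half-plane)] -/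
theorem SU_lower : ∃ c : ℝ, 0 < c ∧ ∃ t₀ : ℕ, ∀ t : ℕ, t₀ ≤ t → c ≤ (P[half]).real SU[t] := by
  obtain ⟨cU, hcU, mU, hU⟩ := HalfPlaneArm.real_U_ge (X := fun v : Site 2 => v 0) (Y := fun v : Site 2 => v 1)
    HalfPlaneArm.axis_X_le HalfPlaneArm.axis_Y_le HalfPlaneArm.axis_injective half HalfPlaneArm.axis_rswLR
    HalfPlaneArm.axis_rswTB
  obtain ⟨cT, hcT, mT, hT⟩ := HalfPlaneArm.tb_lower (X := fun v : Site 2 => v 0) (Y := fun v : Site 2 => v 1)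
    HalfPlaneArm.axis_Y_le half HalfPlaneArm.axis_rswTB 6
  refine ⟨cU * cT, mul_pos hcU hcT, mU + mT + 1, fun t ht => ?_⟩
  have hUt := hU ![32 * (t : ℤ), 0] (2 * (t : ℤ)) (by simp) (by omega) (by simp)
  have hTt := hT (8 * t) (by omega) (28 * (t : ℤ)) (2 * (t : ℤ)) (46 * (t : ℤ)) (by positivity) (by push_cast; omega)
  have hTt' : cT ≤ (P[half]).real TB[(28 : ℤ) * t, (28 : ℤ) * t + 8 * t, (2 : ℤ) * t, (2 : ℤ) * t + 46 * t] := by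
    have e8 : ((8 * t : ℕ) : ℤ) = 8 * (t : ℤ) := by push_cast; ring
    rw [e8] at hTt; exact hTt
  have m1 : MeasurableSet (TB[(32 : ℤ) * t + 2 * t, (32 : ℤ) * t + 2 * (2 * t), (0 : ℤ), (0 : ℤ) + 2 * (2 * t)] ∩
      LR[(32 : ℤ) * t - 2 * (2 * t), (32 : ℤ) * t + 2 * (2 * t), (0 : ℤ) + 2 * t, (0 : ℤ) + 2 * (2 * t)] ∩
      TB[(32 : ℤ) * t - 2 * (2 * t), (32 : ℤ) * t - 2 * t, (0 : ℤ), (0 : ℤ) + 2 * (2 * t)]) :=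
    ((HalfPlaneArm.measurableSet_openCrossing_of_finite (HalfPlaneArm.box_finite HalfPlaneArm.axis_injective _ _ _ _) _ _).inter
      (HalfPlaneArm.measurableSet_openCrossing_of_finite (HalfPlaneArm.box_finite HalfPlaneArm.axis_injective _ _ _ _) _ _)).inter
      (HalfPlaneArm.measurableSet_openCrossing_of_finite (HalfPlaneArm.box_finite HalfPlaneArm.axis_injective _ _ _ _) _ _)
  have m2 : MeasurableSet TB[(28 : ℤ) * t, (28 : ℤ) * t + 8 * t, (2 : ℤ) * t, (2 : ℤ) * t + 46 * t] :=
    HalfPlaneArm.measurableSet_openCrossing_of_finite (HalfPlaneArm.box_finite HalfPlaneArm.axis_injective _ _ _ _) _ _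
  have u1 : IsUpperSet (TB[(32 : ℤ) * t + 2 * t, (32 : ℤ) * t + 2 * (2 * t), (0 : ℤ), (0 : ℤ) + 2 * (2 * t)] ∩
      LR[(32 : ℤ) * t - 2 * (2 * t), (32 : ℤ) * t + 2 * (2 * t), (0 : ℤ) + 2 * t, (0 : ℤ) + 2 * (2 * t)] ∩
      TB[(32 : ℤ) * t - 2 * (2 * t), (32 : ℤ) * t - 2 * t, (0 : ℤ), (0 : ℤ) + 2 * (2 * t)]) :=
    ((isUpperSet_openCrossing _ _ _).inter (isUpperSet_openCrossing _ _ _)).inter (isUpperSet_openCrossing _ _ _)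
  have hH := harris_fkg_holds (zdGraph 2) half u1 (isUpperSet_openCrossing _ _ _) m1 m2
  calc cU * cT ≤ (P[half]).real (TB[(32 : ℤ) * t + 2 * t, (32 : ℤ) * t + 2 * (2 * t), (0 : ℤ), (0 : ℤ) + 2 * (2 * t)] ∩
        LR[(32 : ℤ) * t - 2 * (2 * t), (32 : ℤ) * t + 2 * (2 * t), (0 : ℤ) + 2 * t, (0 : ℤ) + 2 * (2 * t)] ∩
        TB[(32 : ℤ) * t - 2 * (2 * t), (32 : ℤ) * t - 2 * t, (0 : ℤ), (0 : ℤ) + 2 * (2 * t)]) *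
        (P[half]).real TB[(28 : ℤ) * t, (28 : ℤ) * t + 8 * t, (2 : ℤ) * t, (2 : ℤ) * t + 46 * t] :=
      mul_le_mul hUt hTt' hcT.le measureReal_nonneg
    _ ≤ _ := hH

/-- **`P^{G_ray}_{1/2}(η ∈ SU[t]) ≥ c_U`** and **`P^{G_ray}_{1/2}(Φη ∈ SU[t]) ≥ c_U`** for large `t`. [folklore] -/
theorem eta_SU_lower : ∃ c : ℝ, 0 < c ∧ ∃ t₀ : ℕ, ∀ t : ℕ, t₀ ≤ t →
    c ≤ (μ[half]).real ηinv[SU[t]] ∧ c ≤ (μ[half]).real ηinv[(fun ω : BondConfig (Site 2) => refl[ω]) ⁻¹' SU[t]] := by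
  obtain ⟨c, hc, t₀, h⟩ := SU_lower
  refine ⟨c, hc, t₀, fun t ht => ⟨?_, ?_⟩⟩
  · rw [real_eta_plus (determinedBy_SU t) (measurableSet_SU t)]; exact h t ht
  · rw [real_eta_minus (determinedBy_SU t) (measurableSet_SU t)]; exact h t ht

/-- The three rectangles `T_n, B_n, L_n` of Harris' annulus avoid the ray: their crossing events are determined by
pairs none of which is a ray edge. [folklore] -/
theorem short_determined {n : ℕ} (hn : 1 ≤ n) :
    (∃ F : Set (Sym2 (Site 2)), DeterminedBy (topShortCrossing n) F ∧ ∀ k, rayEdge k ∉ F) ∧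
    (∃ F : Set (Sym2 (Site 2)), DeterminedBy (bottomShortCrossing n) F ∧ ∀ k, rayEdge k ∉ F) ∧
    (∃ F : Set (Sym2 (Site 2)), DeterminedBy (leftShortCrossing n) F ∧ ∀ k, rayEdge k ∉ F) := by
  have key : ∀ (F : Finset (Site 2)) (v : Site 2) (A B : Set (Site 2)),
      (∀ z ∈ F, (z + v) 1 ≠ 0 ∨ (z + v) 0 < 0) →
      ∃ F' : Set (Sym2 (Site 2)), DeterminedBy (openCrossing ((· + v) '' (↑F : Set (Site 2))) A B) F' ∧
        ∀ k, rayEdge k ∉ F' := by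
    intro F v A B hF
    refine ⟨_, determinedBy_openCrossing_image F v A B, fun k hk => ?_⟩
    have hmem := Finset.mem_sym2_iff.1 (Finset.mem_coe.1 hk) (rayPt k false) (by rw [rayEdge]; exact Sym2.mem_mk_left _ _)
    obtain ⟨z, hz, hzv⟩ := Finset.mem_image.1 hmem
    rcases hF z hz with h | h
    · apply h; rw [hzv]; simp [rayPt]
    · rw [hzv] at h; simp [rayPt] at h; omega
  refine ⟨key _ _ _ _ fun z hz => ?_, key _ _ _ _ fun z hz => ?_, key _ _ _ _ fun z hz => ?_⟩
  · left; have := (mem_rectangle_iff.1 hz).2.2.1; simp only [Pi.add_apply, topCorner_apply_one]; omega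
  · left; have := (mem_rectangle_iff.1 hz).2.2.2; simp only [Pi.add_apply, bottomCorner_apply_one]; omega
  · right; have := (mem_rectangle_iff.1 hz).2.1; simp only [Pi.add_apply, bottomCorner_apply_zero]; omega

/-- **The three short crossings are unlikely enough**: `P^{G_ray}_{1/2}(ω̃ ∉ T_n), P(ω̃ ∉ B_n), P(ω̃ ∉ L_n) ≥ c_H > 0`
for every `n ≥ 1` (RSW, `rsw_lowerBound.le_one_sub_crossingProb`, transferred off the ray).
[cite: BollobasRiordan2006, Ch. 3, eq. (3)–(4)] -/
theorem short_lower : ∃ c : ℝ, 0 < c ∧ ∀ n : ℕ, 1 ≤ n →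
    c ≤ (μ[half]).real (effConfig ⁻¹' (topShortCrossing n)ᶜ) ∧ c ≤ (μ[half]).real (effConfig ⁻¹' (bottomShortCrossing n)ᶜ) ∧
    c ≤ (μ[half]).real (effConfig ⁻¹' (leftShortCrossing n)ᶜ) := by
  obtain ⟨c, hc, h⟩ := rsw_lowerBound.le_one_sub_crossingProb rsw_lowerBound_holds
  refine ⟨c, hc, fun n hn => ?_⟩
  obtain ⟨⟨FT, dT, rT⟩, ⟨FB, dB, rB⟩, ⟨FL, dL, rL⟩⟩ := short_determined hn
  have mT : MeasurableSet (topShortCrossing n) := measurableSet_openCrossing_image _ _ _ _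
  have mB : MeasurableSet (bottomShortCrossing n) := measurableSet_openCrossing_image _ _ _ _
  have mL : MeasurableSet (leftShortCrossing n) := measurableSet_openCrossing_image _ _ _ _
  refine ⟨?_, ?_, ?_⟩
  · rw [real_preimage_effConfig_of_not_ray half dT.compl rT mT.compl, probReal_compl_eq_one_sub mT,
      real_topShortCrossing]; exact h n hn
  · rw [real_preimage_effConfig_of_not_ray half dB.compl rB mB.compl, probReal_compl_eq_one_sub mB,
      real_bottomShortCrossing]; exact h n hn
  · rw [real_preimage_effConfig_of_not_ray half dL.compl rL mL.compl, probReal_compl_eq_one_sub mL,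
      real_leftShortCrossing]; exact h n hn

end Ray

end Summit.CriticalPhenomena.PercolationContinuityZ3.Theorems.TransplantSharpness
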